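import Mathlib.Topology.MetricSpace.HausdorffDistance
import Literature.Probability.RandomPlanarGeometry.PlanarDomains
import Literature.Probability.LatticeModels.MedialInterface
import HarnessLib

/-!
# Discretisations of a Dobrushin domain by square-lattice Dobrushin data (model-independent)

The hypothesis structure "the discrete Dobrushin data `E δ`, `δ > 0`, discretise the Dobrushin
domain `(D; a, b)`" — CDHKS's approximations `(Ω_δ; a_δ, b_δ) → (Ω; a, b)` (Chelkak–Duminil-Copin–
Hongler–Kemppainen–Smirnov, C. R. Math. 352 (2014), §1; Chelkak–Smirnov, Invent. Math. 189 (2012),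
§3.2; Smirnov, ICM 2006, §2.1) specialised to the tree's canonical vertex set `meshDomain` — housed
in a LIGHT file that imports only `MedialInterface` (G02's `DiscreteDobrushin`, `medialPoint`,
`zdABEdges`, `IsZdAdmissible`) and `PlanarDomains` (`DobrushinDomain`), and none of the Ising /
FK / fermionic-observable files.

This is the hoist asked for by definition item `defn-ZdDiscretisationFamily` (route repair of
CriticalPhenomena/CardySusyWard, 2026-08-15): the same six fields as
`Literature.Probability.LatticeModels.IsDiscretisation` of `InterfaceSLE.lean` (which sits behind
the imports `PlanarIsing`, `FermionicObservable`, `RandomCluster`, …), under the new name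
`ZdDiscretisationFamily`, so that the percolation-side statement
`Literature.Probability.Percolation.SLE6LimitZ2AllDiscretisations`
(`InterfaceScalingLimitDiscretised.lean`) can be re-based on this file and become cone-neutral
relative to `InterfaceScalingLimit.lean`. NO statement is changed: the fields are copied verbatim;
the equivalence with `IsDiscretisation` is one `fun h ↦ ⟨h.1, …, h.6⟩` in each direction and is
to be recorded in `InterfaceSLE.lean` (which imports this file's cone already) when that file is
next revised.

* `ZdDiscretisationFamily D E` — fields `Ω_eq`, `δ_eq`, `tendsto_arcA`, `tendsto_arcB`,
  `tendsto_zdABEdges`, `eventually_isZdAdmissible` (verbatim from `IsDiscretisation`);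
* `ZdDiscretisationFamily.meshDomain_eq` — the discrete domain at mesh `δ` is `meshDomain D δ`.

## References

* D. Chelkak, H. Duminil-Copin, C. Hongler, A. Kemppainen, S. Smirnov, *Convergence of Ising
  interfaces to Schramm's SLE curves*, C. R. Math. Acad. Sci. Paris 352 (2014) 157–161, §1
  [CDHKSCRAS2014].
* D. Chelkak, S. Smirnov, *Universality in the 2D Ising model and conformal invariance of
  fermionic observables*, Invent. Math. 189 (2012), §3.2 [ChelkakSmirnov2012].
* S. Smirnov, *Towards conformal invariance of 2D lattice models*, ICM 2006, §2.1 [Smirnov2007ICM].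
-/

noncomputable section

open Filter Topology

namespace Literature.Probability.LatticeModels

/-- `ZdDiscretisationFamily D E`: the family `E δ` (`δ > 0`) of G02 discrete Dobrushin data
*discretises* the Dobrushin domain `(D; a, b)` in the sense of CDHKS's approximations
`(Ω_δ; a_δ, b_δ) → (Ω; a, b)`, specialised to the canonical vertex set: the domain is `D.carrier`
(so `Ω_δ = meshDomain D.carrier δ`) and the mesh is `δ`; the two arcs of the data converge to the
boundary arcs `(ab) = D.arc 0`, `(ba) = D.arc 1` in the Hausdorff extended distance; the discrete
marked points — the midpoints of the `A`–`B` boundary edges `e_a`, `e_b`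
(`DiscreteDobrushin.zdABEdges`) — converge to `{a, b}`; and the data are admissible
(`IsZdAdmissible`) for all small `δ > 0`, so that G02's exploration path is not junk. The
model-independent copy (same fields, verbatim) of `IsDiscretisation` of `InterfaceSLE.lean`,
hoisted to a light import cone. (CDHKS 2014, §1; Chelkak–Smirnov 2012, §3.2.)
[cite: CDHKSCRAS2014, §1] -/
structure ZdDiscretisationFamily (D : RandomPlanarGeometry.DobrushinDomain)
    (E : ℝ → DiscreteDobrushin) : Prop where
  /-- The domain of the data at every mesh is `D`. -/
  Ω_eq : ∀ δ, (E δ).Ω = D.carrier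
  /-- The mesh of the data at mesh `δ` is `δ`. -/
  δ_eq : ∀ δ, (E δ).δ = δ
  /-- The `+`/wired arcs converge to `(ab)` in Hausdorff distance. -/
  tendsto_arcA :
    Tendsto (fun δ => Metric.hausdorffEDist (E δ).arcA (D.arc 0)) (𝓝[>] 0) (𝓝 0)
  /-- The `−`/free arcs converge to `(ba)` in Hausdorff distance. -/
  tendsto_arcB :
    Tendsto (fun δ => Metric.hausdorffEDist (E δ).arcB (D.arc 1)) (𝓝[>] 0) (𝓝 0)
  /-- The discrete marked points `a_δ`, `b_δ` (midpoints of the `A`–`B` edges) converge to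
  `{a, b}` in Hausdorff distance. -/
  tendsto_zdABEdges :
    Tendsto (fun δ => Metric.hausdorffEDist (medialPoint δ '' (E δ).zdABEdges) {D.pt 0, D.pt 1})
      (𝓝[>] 0) (𝓝 0)
  /-- The data are admissible for all small positive meshes. -/
  eventually_isZdAdmissible : ∀ᶠ δ in 𝓝[>] (0 : ℝ), (E δ).IsZdAdmissible

namespace ZdDiscretisationFamily

variable {D : RandomPlanarGeometry.DobrushinDomain} {E : ℝ → DiscreteDobrushin}

/-- For a discretisation family, the discrete domain at mesh `δ` is the canonical
`meshDomain D δ`. (Chelkak–Smirnov 2012, §3.2.) [cite: ChelkakSmirnov2012, §3.2] -/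
theorem meshDomain_eq (h : ZdDiscretisationFamily D E) (δ : ℝ) :
    meshDomain (E δ).Ω (E δ).δ = meshDomain D.carrier δ := by
  rw [h.Ω_eq, h.δ_eq]

/-- The discrete domains of a discretisation family are finite at positive mesh (the domain `D`
is bounded). [folklore] -/
theorem meshDomain_finite (h : ZdDiscretisationFamily D E) {δ : ℝ} (hδ : 0 < δ) :
    (meshDomain (E δ).Ω (E δ).δ).Finite := by
  rw [h.meshDomain_eq]
  exact LatticeModels.meshDomain_finite D.isBounded hδ

end ZdDiscretisationFamily

end Literature.Probability.LatticeModels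

end
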